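import Summits.BirchSwinnertonDyer.BirchSwinnertonDyer.Theorems.AlignedTransportAtTwoMainConjectureOfRankZeroBSDAtTwoCubicLayerOneDoors
import Literature.NumberTheory.IwasawaTheory.ClassNumberPExpLayerOneGeTwoOfOrderFourCertificate
import HarnessLib

/-!
# Route `AlignedTransportAtTwo`, crux C2 `MainConjectureOfRankZeroBSDAtTwo` (stmt-BirchSwinnertonDyer-22298):
# THE ORDER-FOUR DOOR — `e₁ = ord₂ h(ℚ(β,√2)) ≥ 2` for the cubic `2`-torsion field of a curve with `Δ_W < 0` and irreducible `W[2]`,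
# from an ORDER-FOUR CERTIFICATE written in `𝓞_{ℚ(β)}` (three units of `ℚ(β,√2)` modulo `±` squares, an ideal of order `4`, residue certificates)

HONEST FRAMING (cell `bsd-f1-sign2`, WIDTH-5 attached prover seat `bsd-line-att-p4` gen 40 on line `birth` of the lead `bsd-line-att-p2`;
`--supports` stmt-BirchSwinnertonDyer-22298, closes nothing; BSD is NOT proved by any of this; the crux C2, its verdict «blocked-on
`Rank1Residual.GreenbergMuConjectureIrreducible`» and every registered stub are untouched).  THEOREMS ONLY — no definition, no named fact, no `sorry`.

WHY / WHAT.  On the u7 sub-cell (`Δ_min ≡ 5 (mod 8)`, `h(ℚ(β))` odd, `σ₁(ε) ≡ ±1 (mod 8)`) the invariant `e₁ = ord₂ h(K_1)`, `K_1 = ℚ(β,√2)`, decides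
which door can fire; att-p3 g46's PRO-CYCLIC DOOR needs `e₁ ≥ 2` (with `t = 3`), a NON-PRINCIPALITY statement in the sextic field `K_1` that the
cell had only census-grade (att-p4 g39 memo §2: `12163`, `14539`, `1187`, `4307`, `13971`, `13547`).  This seat's Literature theorems
`NumberFields.four_dvd_card_classGroup_of_orderFourCert` / `IwasawaTheory.two_le_classNumberPExp_one_of_orderFourCert` decide it from data of
the CUBIC field alone: coordinates on `1, √2` of three units of `K_1` (with inverses), of a generator `w` of `𝔔⁴` for a prime `𝔔 = (q₀, v)` of `K_1`
above a split prime `(q₀)` of `ℚ(β)`, ring witnesses for `(q₀, v)² = (w, q₀²)`, `(w, q₀²)² = (w)`, and `31` residue certificates (ring maps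
`𝓞_{ℚ(β)} → ℤ/q` at split primes) showing that no `±u₁^{e₁}u₂^{e₂}u₃^{e₃}w^{e₄}` is a square — so `(w, q₀²) = 𝔔²` is not principal (Dirichlet:
`rank E_{K_1} = 3`) and `[𝔔]` has order `4`.
* **`two_le_classNumberPExp_one_adjoin_of_orderFourCert`** — `W/ℚ` elliptic with no rational `2`-torsion abscissa and `Δ_W < 0`, `β` a root of the
  `2`-division cubic, `2 ∤ d_{ℚ(β)}`, the certificate data ⟹ `2 ≤ classNumberPExp κ 1` for every cyclotomic `ℤ₂`-extension `κ` of `ℚ(β)`.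
First customer (same seat, separate file): `N = 12163` (`[1,1,1,−4,−8]`, `d = −12163`, `h = 1`, `t = 3`, regime (β)).

Nothing is asserted about `μ₂` or `MC₂`; nothing is closed; BSD is not proved.

References: [NeukirchANT1999] Ch. I §3, §7 Thm. (7.4), §8; [Cohen1993] §4.7, §6.5, Prop. 4.8.11; [Washington1997] §13.1; [Marcus2018] Ch. 3 Thm. 27;
[SilvermanAEC2009] III.§1; tree: this seat's Literature `NumberFields/QuadraticSqrtTwoClassNumberDvdFourCertificate`,
`IwasawaTheory/ClassNumberPExpLayerOneGeTwoOfOrderFourCertificate`, att-p3/att-p5 `…CubicLayerOneDoors` (`r₁(ℚ(β)) = 1`).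
-/

set_option linter.dupNamespace false
set_option autoImplicit false

noncomputable section

open scoped Classical NumberField nonZeroDivisors

namespace Summit.BirchSwinnertonDyer.BirchSwinnertonDyer.Theorems.AlignedTransportAtTwoCubicOrderFourDoor

open NumberField IsDedekindDomain Polynomial WeierstrassCurve IntermediateField CongruenceSubgroup
  Literature.NumberTheory.IwasawaTheory Literature.NumberTheory.GaloisRepresentations
  Literature.NumberTheory.EllipticCurves Literature.NumberTheory.EllipticCurves.Greenberg1999
  Literature.NumberTheory.EllipticCurves.ModularForms
  Literature.NumberTheory.EllipticCurves.Rank1Residual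
  Literature.NumberTheory.EllipticCurves.Module
  Literature.NumberTheory.NumberFields
  Summit.BirchSwinnertonDyer.Rank1Residual
  Summit.BirchSwinnertonDyer.Rank1Residual.X1.MuLambda
  Summit.BirchSwinnertonDyer.Rank1Residual.X5
  Summit.BirchSwinnertonDyer.Rank1Residual.F1Sign2
  Summit.BirchSwinnertonDyer.BirchSwinnertonDyer.Theorems.Rank1ResidualX1Defs
  Summit.BirchSwinnertonDyer.BirchSwinnertonDyer.Theses.AlignedTransportAtTwo
  Summit.BirchSwinnertonDyer.BirchSwinnertonDyer.Theorems.AlignedTransportAtTwoCubicCarrierRoad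
  Summit.BirchSwinnertonDyer.BirchSwinnertonDyer.Theorems.AlignedTransportAtTwoCubicLayerOneDoors

variable (W : WeierstrassCurve ℚ) [W.IsElliptic]

/-- **`e₁(κ) ≥ 2` FOR THE CUBIC `2`-TORSION FIELD FROM AN ORDER-FOUR CERTIFICATE.**  `W/ℚ` elliptic with no rational `2`-torsion abscissa (`W[2]`
irreducible, `[ℚ(β):ℚ] = 3`) and `Δ_W < 0` (one real place, two infinite places), `β ∈ ℚ̄` a root of the `2`-division cubic, `2 ∤ d_{ℚ(β)}` (so `√2 ∉ ℚ(β)`),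
`κ` a cyclotomic `ℤ₂`-extension of `ℚ(β)` (`K_1 = ℚ(β, s)`, `s² = 2`).  DATA in `𝓞_{ℚ(β)}` (coordinates on `1, s`): three units `a_i + b_i s` with inverses
`c_i + d_i s`; `w = A + Bs`, `w* = W₀ + W₁s` with `q₀⁴ = w w*`, `μw + νw* = 1`; `v = v₀ + v₁ s` with witnesses for `q₀v, v² ∈ (w, q₀²)` and `w ∈ (q₀², q₀v, v²)`;
`q₀ ≠ 0`; and for every pattern `(e₁,e₂,e₃,e₄,±) ≠ (0,0,0,0,+)`, `e_i ≤ 1`, a residue certificate (`ψ : 𝓞_{ℚ(β)} → ℤ/q`, `2t = 1`, `ψ(ρ)² = 2`,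
`±∏(ψa_i + ψb_i·ψρ)^{e_i}(ψA + ψB·ψρ)^{e₄}` not a square).  THEN **`2 ≤ classNumberPExp κ 1`** (`4 ∣ h(ℚ(β,√2))`: the class of `(q₀, v)` has order `4`).
[cite: NeukirchANT1999, Ch. I §7 Thm. (7.4), Ch. I §3, Ch. I §8] [cite: Cohen1993, §6.5 and Prop. 4.8.11] [cite: Washington1997, §13.1] -/
theorem two_le_classNumberPExp_one_adjoin_of_orderFourCert (ht : ∀ x : ℚ, ¬ HasRationalTwoTorsionX W x) (hΔ : W.Δ < 0)
    {β : AlgebraicClosure ℚ} (hβ : aeval β W.twoTorsionPolynomial.toPoly = 0)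
    (hd : haveI : FiniteDimensional ℚ ↥(IntermediateField.adjoin ℚ ({β} : Set (AlgebraicClosure ℚ))) :=
        IntermediateField.adjoin.finiteDimensional ((AlgebraicClosure.isAlgebraic ℚ).isAlgebraic β).isIntegral
      haveI : NumberField ↥(IntermediateField.adjoin ℚ ({β} : Set (AlgebraicClosure ℚ))) := NumberField.mk
      ¬ (2 : ℤ) ∣ NumberField.discr ↥(IntermediateField.adjoin ℚ ({β} : Set (AlgebraicClosure ℚ))))
    {a₁ b₁ c₁ d₁ a₂ b₂ c₂ d₂ a₃ b₃ c₃ d₃ A B W₀ W₁ μ₀ μ₁ ν₀ ν₁ q₀ v₀ v₁ α₀ α₁ β₀ β₁ γ₀ γ₁ δ₀ δ₁ m₀ m₁ n₀ n₁ l₀ l₁ :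
      𝓞 ↥(IntermediateField.adjoin ℚ ({β} : Set (AlgebraicClosure ℚ)))}
    (hu₁ : a₁ * c₁ + 2 * b₁ * d₁ = 1 ∧ a₁ * d₁ + b₁ * c₁ = 0)
    (hu₂ : a₂ * c₂ + 2 * b₂ * d₂ = 1 ∧ a₂ * d₂ + b₂ * c₂ = 0)
    (hu₃ : a₃ * c₃ + 2 * b₃ * d₃ = 1 ∧ a₃ * d₃ + b₃ * c₃ = 0)
    (hws : q₀ ^ 4 = A * W₀ + 2 * B * W₁ ∧ (0 : 𝓞 ↥(IntermediateField.adjoin ℚ ({β} : Set (AlgebraicClosure ℚ)))) = A * W₁ + B * W₀)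
    (hbez : μ₀ * A + 2 * μ₁ * B + ν₀ * W₀ + 2 * ν₁ * W₁ = 1 ∧ μ₀ * B + μ₁ * A + ν₀ * W₁ + ν₁ * W₀ = 0)
    (hq₀ : q₀ ≠ 0)
    (hM2 : q₀ * v₀ = α₀ * A + 2 * α₁ * B + β₀ * q₀ ^ 2 ∧ q₀ * v₁ = α₀ * B + α₁ * A + β₁ * q₀ ^ 2)
    (hM3 : v₀ ^ 2 + 2 * v₁ ^ 2 = γ₀ * A + 2 * γ₁ * B + δ₀ * q₀ ^ 2 ∧ 2 * v₀ * v₁ = γ₀ * B + γ₁ * A + δ₁ * q₀ ^ 2)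
    (hM4 : A = m₀ * q₀ ^ 2 + (n₀ * (q₀ * v₀) + 2 * n₁ * (q₀ * v₁)) + (l₀ * (v₀ ^ 2 + 2 * v₁ ^ 2) + 2 * l₁ * (2 * v₀ * v₁)) ∧
      B = m₁ * q₀ ^ 2 + (n₀ * (q₀ * v₁) + n₁ * (q₀ * v₀)) + (l₀ * (2 * v₀ * v₁) + l₁ * (v₀ ^ 2 + 2 * v₁ ^ 2)))
    (hcert : ∀ (e₁ e₂ e₃ e₄ : ℕ) (σ : ℤˣ), e₁ ≤ 1 → e₂ ≤ 1 → e₃ ≤ 1 → e₄ ≤ 1 →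
      ¬ (e₁ = 0 ∧ e₂ = 0 ∧ e₃ = 0 ∧ e₄ = 0 ∧ σ = 1) →
      ∃ (q : ℕ) (ψ : 𝓞 ↥(IntermediateField.adjoin ℚ ({β} : Set (AlgebraicClosure ℚ))) →+* ZMod q) (t : ZMod q)
        (ρ : 𝓞 ↥(IntermediateField.adjoin ℚ ({β} : Set (AlgebraicClosure ℚ)))), 2 * t = 1 ∧ ψ ρ ^ 2 = 2 ∧
        ¬ IsSquare (((σ : ℤ) : ZMod q) * (ψ a₁ + ψ b₁ * ψ ρ) ^ e₁ * (ψ a₂ + ψ b₂ * ψ ρ) ^ e₂ *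
          (ψ a₃ + ψ b₃ * ψ ρ) ^ e₃ * (ψ A + ψ B * ψ ρ) ^ e₄))
    (κP : ZpExtension ↥(IntermediateField.adjoin ℚ ({β} : Set (AlgebraicClosure ℚ))) 2) (hκP : κP.IsCyclotomic) :
    2 ≤ classNumberPExp κP 1 := by
  have hirr := AlignedTransportAtTwoSeed.irr_two_of_forall_not_hasRationalTwoTorsionX W ht
  have hβint : IsIntegral ℚ β := ((AlgebraicClosure.isAlgebraic ℚ).isAlgebraic β).isIntegral
  haveI : FiniteDimensional ℚ ↥(IntermediateField.adjoin ℚ ({β} : Set (AlgebraicClosure ℚ))) :=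
    IntermediateField.adjoin.finiteDimensional hβint
  haveI : NumberField ↥(IntermediateField.adjoin ℚ ({β} : Set (AlgebraicClosure ℚ))) := NumberField.mk
  haveI : FiniteDimensional ↥(IntermediateField.adjoin ℚ ({β} : Set (AlgebraicClosure ℚ))) (κP.layer 1) :=
    κP.finiteDimensional_layer_holds 1
  haveI : NumberField (κP.layer 1) := NumberField.of_module_finite ↥(IntermediateField.adjoin ℚ ({β} : Set (AlgebraicClosure ℚ))) _
  have h3 : Module.finrank ℚ ↥(IntermediateField.adjoin ℚ ({β} : Set (AlgebraicClosure ℚ))) = 3 :=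
    AddKatoTwo.finrank_adjoin_root_twoTorsionPolynomial_eq_three W hirr hβ
  have hodd3 : ¬ 2 ∣ Module.finrank ℚ ↥(IntermediateField.adjoin ℚ ({β} : Set (AlgebraicClosure ℚ))) := by rw [h3]; decide
  have hr1 := nrRealPlaces_adjoin_root_twoTorsionPolynomial_eq_one W hΔ hirr hβ
  have hreal : 0 < InfinitePlace.nrRealPlaces ↥(IntermediateField.adjoin ℚ ({β} : Set (AlgebraicClosure ℚ))) := by rw [hr1]; exact one_pos
  have hPl : Fintype.card (InfinitePlace ↥(IntermediateField.adjoin ℚ ({β} : Set (AlgebraicClosure ℚ)))) ≤ 2 := by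
    have h := InfinitePlace.card_add_two_mul_card_eq_rank (K := ↥(IntermediateField.adjoin ℚ ({β} : Set (AlgebraicClosure ℚ))))
    rw [h3, hr1] at h
    rw [InfinitePlace.card_eq_nrRealPlaces_add_nrComplexPlaces, hr1]
    omega
  exact two_le_classNumberPExp_one_of_orderFourCert hodd3 hd hreal hPl κP hκP hu₁ hu₂ hu₃ hws hbez hq₀ hM2 hM3 hM4 hcert

end Summit.BirchSwinnertonDyer.BirchSwinnertonDyer.Theorems.AlignedTransportAtTwoCubicOrderFourDoor

end
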